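import Mathlib
import Summits.KontsevichZagierPeriods.Zeta5Search.BigPrimeBelowB0Sharp
import Summits.KontsevichZagierPeriods.Zeta5Search.ValuationLawsAboveB0
import HarnessLib

/-!
# ζ(5) search — the law (WV) is a THEOREM at every prime `p ≥ max(5, b₀ + 1 − 2b₍₂₎)`

Cell `pub-zeta5` (HONEST FRAMING: systematic search; no irrationality claim unless certified), typer seat
generation 7.  The OBSERVED law (WV) of `CasoratianValuation.lean` reads
`min(1,⌊(d+1)/p⌋) + a_p(b) − Σ_{i<k}⌊(b₀−b_i−b_k)/p⌋ ≤ v_p(W(b))`.  Since every "top partner" `k` contributes the pair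
`{k, k₀}` with `⌊(b₀−b_k−b_min)/p⌋ ≥ 1` to the pair-floor sum, `a_p ≤ Σ⌊…⌋` always (`topPartners_le_pairFloors`), so the
law asks for at most `min(1,⌊(d+1)/p⌋) ≤ v_p(W)`; by `BigPrimeBelowB0` ((W∞) below `b₀`) and `BigPrimeBelowB0Sharp`
(`p`-integrality of `W` on the support window) this holds at every prime `p ≥ max(5, b₀+1−2b_{j₂})`
(`zeta3CoefficientValuationLaw_of_slot`).  What remains observed of (WV) is `5 ≤ p ≤ b₀ − 2b₍₂₎`.  OUR theorem.
-/

noncomputable section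

open Finset

namespace Summit.KontsevichZagierPeriods.Zeta5Search.BigPrime

open Summit.KontsevichZagierPeriods.Zeta5Search.DualSeries (InBox)
open Summit.KontsevichZagierPeriods.Zeta5Search.WedgeDictionary (coeffW dOf)
open Summit.KontsevichZagierPeriods.Zeta5Search.CasoratianValuation (InPolytope refundW pairFloors bMin topPartners)

/-- In the polytope every pair block is non-negative: `0 ≤ b₀ − b_i − b_k`. -/
theorem pairBlock_nonneg (b : ℕ → ℤ) (hb : InPolytope b) {i k : ℕ} (hi : i ∈ range 7) (hk : k ∈ range 7) :
    0 ≤ b 0 - b (i + 1) - b (k + 1) := by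
  have := hb.2.1 i hi; have := hb.2.1 k hk; omega

/-- **`a_p(b) ≤ Σ_{i<k} ⌊(b₀ − b_i − b_k)/p⌋`** for `b` in the polytope and `p ≥ 1`. -/
theorem topPartners_le_pairFloors (b : ℕ → ℤ) (hb : InPolytope b) {p : ℕ} (hp : 0 < p) :
    topPartners b p ≤ pairFloors b p := by
  -- a slot `k₀` carrying the minimal parameter
  obtain ⟨k₀, hk₀, hk₀min⟩ : ∃ k₀ ∈ range 7, b (k₀ + 1) = bMin b := by
    have hmem := Finset.min'_mem ((range 7).image fun i => b (i + 1)) (by simp)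
    obtain ⟨i, hi, h⟩ := mem_image.1 hmem
    exact ⟨i, hi, by rw [bMin]; exact h⟩
  have hp' : (0 : ℤ) < p := by exact_mod_cast hp
  -- the matrix of pair floors and its non-negativity
  set f : ℕ → ℕ → ℤ := fun i k => if i < k then (b 0 - b (i + 1) - b (k + 1)) / (p : ℤ) else 0 with hf
  have hfnn : ∀ i ∈ range 7, ∀ k ∈ range 7, 0 ≤ f i k := by
    intro i hi k hk
    simp only [hf]
    split_ifs
    · exact Int.ediv_nonneg (pairBlock_nonneg b hb hi hk) hp'.le
    · exact le_refl _
  have hpair : pairFloors b p = ∑ q ∈ range 7 ×ˢ range 7, f q.1 q.2 := by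
    rw [pairFloors, sum_product]
  -- the partner pairs `i ↦ (min i k₀, max i k₀)`, injective on `i ≠ k₀`
  set g : ℕ → ℕ × ℕ := fun i => (min i k₀, max i k₀) with hg
  have hginj : Set.InjOn g ((range 7).erase k₀ : Finset ℕ) := by
    intro i hi i' hi' h
    have hi0 : i ≠ k₀ := (Finset.mem_erase.1 (Finset.mem_coe.1 hi)).1
    have hi0' : i' ≠ k₀ := (Finset.mem_erase.1 (Finset.mem_coe.1 hi')).1
    simp only [hg, Prod.mk.injEq] at h
    obtain ⟨h1, h2⟩ := h
    rcases lt_or_gt_of_ne hi0 with hlt | hgt <;> rcases lt_or_gt_of_ne hi0' with hlt' | hgt'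
    · rw [min_eq_left hlt.le, min_eq_left hlt'.le] at h1; exact h1
    · rw [min_eq_left hlt.le, min_eq_right hgt'.le] at h1; omega
    · rw [min_eq_right hgt.le, min_eq_left hlt'.le] at h1; omega
    · rw [max_eq_left hgt.le, max_eq_left hgt'.le] at h2; exact h2
  have hgsub : ((range 7).erase k₀).image g ⊆ range 7 ×ˢ range 7 := by
    intro q hq
    obtain ⟨i, hi, rfl⟩ := mem_image.1 hq
    have hi7 := mem_range.1 (mem_erase.1 hi).2
    have hk7 := mem_range.1 hk₀
    simp only [hg, mem_product, mem_range]
    constructor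
    · exact lt_of_le_of_lt (min_le_left _ _) hi7
    · exact max_lt hi7 hk7
  -- termwise: the indicator of a top partner is at most its pair floor
  have hterm : ∀ i ∈ (range 7).erase k₀,
      (if (p : ℤ) ≤ b 0 - b (i + 1) - bMin b then (1 : ℤ) else 0) ≤ f (g i).1 (g i).2 := by
    intro i hi
    have hi' := mem_erase.1 hi
    have hval : f (g i).1 (g i).2 = (b 0 - b (i + 1) - b (k₀ + 1)) / (p : ℤ) := by
      rcases lt_or_gt_of_ne hi'.1 with hlt | hgt
      · simp only [hf, hg, min_eq_left hlt.le, max_eq_right hlt.le, if_pos hlt]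
      · simp only [hf, hg, min_eq_right hgt.le, max_eq_left hgt.le, if_pos hgt]
        congr 1; ring
    rw [hval, hk₀min]
    split_ifs with hc
    · exact (Int.le_ediv_iff_mul_le hp').2 (by simpa using hc)
    · exact Int.ediv_nonneg (by rw [← hk₀min]; exact pairBlock_nonneg b hb hi'.2 hk₀) hp'.le
  -- assemble
  have hcard : topPartners b p = ∑ i ∈ (range 7).erase k₀,
      (if (p : ℤ) ≤ b 0 - b (i + 1) - bMin b then (1 : ℤ) else 0) := by
    rw [topPartners]
    have hsplit := add_sum_erase (range 7)
      (fun i => if (p : ℤ) ≤ b 0 - b (i + 1) - bMin b then (1 : ℤ) else 0) hk₀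
    rw [hk₀min, show b 0 - bMin b - bMin b = b 0 - 2 * bMin b by ring] at hsplit
    have hc : (((range 7).filter fun i => (p : ℤ) ≤ b 0 - b (i + 1) - bMin b).card : ℤ) =
        ∑ i ∈ range 7, (if (p : ℤ) ≤ b 0 - b (i + 1) - bMin b then (1 : ℤ) else 0) := by
      rw [Finset.card_filter]; push_cast; rfl
    rw [hc, ← hsplit]
    split_ifs <;> ring
  calc topPartners b p
      = ∑ i ∈ (range 7).erase k₀, (if (p : ℤ) ≤ b 0 - b (i + 1) - bMin b then (1 : ℤ) else 0) := hcard
    _ ≤ ∑ i ∈ (range 7).erase k₀, f (g i).1 (g i).2 := sum_le_sum hterm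
    _ = ∑ q ∈ ((range 7).erase k₀).image g, f q.1 q.2 := by rw [sum_image hginj]
    _ ≤ ∑ q ∈ range 7 ×ˢ range 7, f q.1 q.2 :=
        sum_le_sum_of_subset_of_nonneg hgsub fun q hq _ => hfnn q.1 (mem_product.1 hq).1 q.2 (mem_product.1 hq).2
    _ = pairFloors b p := hpair.symm

/-- **(WV) holds at every prime `p ≥ max(5, b₀ + 1 − 2b_{j₂})`** (`j₂` minimal among the slots other than some `j₁`). -/
theorem zeta3CoefficientValuationLaw_of_slot (b : ℕ → ℤ) (p j₁ j₂ : ℕ) (hb : InPolytope b)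
    (hj₁ : j₁ ∈ range 7) (hmin : ∀ j ∈ range 7, j ≠ j₁ → b (j₂ + 1) ≤ b (j + 1))
    (hprime : p.Prime) (hp5 : 5 ≤ p) (hpS : b 0 + 1 ≤ (p : ℤ) + 2 * b (j₂ + 1)) (hW : coeffW b ≠ 0) :
    refundW b p + topPartners b p - pairFloors b p ≤ padicValRat p (coeffW b) := by
  haveI : Fact p.Prime := ⟨hprime⟩
  have htp := topPartners_le_pairFloors b hb hprime.pos
  have hv : refundW b p ≤ padicValRat p (coeffW b) := by
    rcases le_or_gt (p : ℤ) (dOf b + 1) with hin | hout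
    · rw [refundW_eq_one b hprime.pos hin]
      exact one_le_padicValRat_coeffW_of_slot b p j₁ j₂ hb.1 hb.2.1 hb.2.2 hj₁ hmin hprime hp5 hpS hin hW
    · rw [refundW_eq_zero b hb hout]
      obtain ⟨hWn, -⟩ := padicNorm_coeff_le_one_of_slot (p := p) b j₁ j₂ hb.1 hb.2.1 hb.2.2 hj₁ hmin hpS
      exact padicValRat_nonneg_of_padicNorm_le_one hW hWn
  omega

end Summit.KontsevichZagierPeriods.Zeta5Search.BigPrime

end
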